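import Summits.Ventures.YMGap.RobustBall.StateStability
import Summits.Ventures.YMGap.Thresholds.StateLipschitzRows
import Summits.Ventures.YMGap.RobustBall.RowsSU2
import HarnessLib

/-!
# Venture YMGap, track ROBUST-BALL — STATE-STABILITY, rows: hypothesis-free instances of the continuity of the
# strong-coupling state across rb-p1's `ℤ^d` ball (`SU(2)`, `d = 4` via the quarter modulus; every `SU(N)` via the
# Bakry–Émery modulus)

HONEST FRAMING: venture file of the cell `pub-ymgap` (QuantumFields programme), track Y2 ROBUST-BALL, seat ds-1; companion
of `RobustBall/StateStability.lean`.  Strong-coupling LATTICE statements inside the one-link Dobrushin window; Lipschitz /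
continuity statements about DLR states of perturbed actions; no mass-gap claim for the members here, nothing about the
continuum or the Clay problem.

* `su2_abs_integral_sub_integral_le_of_memBallZd` — `SU(2)`, `d = 4`, Wilson units, HYPOTHESIS-FREE: for `0 ≤ β_W < 2/9`,
  every member of `MemBallZd ε₀ ε₁ R'` (any `ε₀`), every DLR state `ν` of the member and the Wilson DLR state `μ` at bare
  coupling `β_W/2`: `|∫ f dμ − ∫ f dν| ≤ (√2 ε₀ / (2 − 9β_W)) · Σ δ(f)`.
* `abs_integral_sub_integral_le_of_memBallZd_SU` — every `N ≥ 2`, `d ≥ 2`, HYPOTHESIS-FREE: for `|β| ≤ b₀ < 1/(16(d−1))`,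
  `|∫ f dμ − ∫ f dν| ≤ (√N ε₀ / (2(1 − 16(d−1)b₀))) · Σ δ(f)`.

* `su2_abs_integral_sub_integral_le_of_members` — `SU(2)`, `d = 4`: THE STATE IS LIPSCHITZ ACROSS THE BALL in the
  oscillation-load seminorm, with rb-p1's lineage-(B) door constant: for `0 ≤ β_W ≤ 1/6`, two members `(W₁, supp)`,
  `(W₂, supp)` of the one-parameter ball `MemBallZd (2ε) ε R'` with `ρ = 3√3 β_W e^{2ε} + e^{ε} √(2/3) ε < 1`, and the
  oscillation load `η` of `W₁ − W₂`: `|∫ f dν₁ − ∫ f dν₂| ≤ (√2 η / 2)/(1 − ρ) · Σ δ(f)` for all DLR states `ν₁, ν₂` of the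
  two members (the contraction of member 1 is rb-p1's `isKRContraction_perturbedYM_SU` with the sharp pair
  `(c, v) = (2/3, 2)`).

References (mechanism): H. Föllmer, LNM 1362 (1988), Ch. I (2.8); H. Shen, R. Zhu, X. Zhu, CMP 400 (2023), Lemma 4.1.
-/

noncomputable section

open MeasureTheory Function Finset ProbabilityTheory Real
open scoped NNReal
open Literature.Probability.LatticeModels
open Literature.Probability.LatticeModels.DobrushinMetric
open Literature.MathematicalPhysics.QuantumLattice
open Literature.MathematicalPhysics.QuantumFieldTheory hiding ZdEdge
open Literature.MathematicalPhysics.QuantumFieldTheory.Balaban1983to89.StrongCouplingDobrushinWindow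
open Literature.MathematicalPhysics.QuantumFieldTheory.Balaban1983to89.StrongCouplingKernelWindow
  (oneLinkKRModulus_SU)
open Summit.QuantumFields.BalabanUV.InfraRed.StrongCouplingPoincareDoorSUN (oneLinkPoincareSUN_two_sharp)
open Summit.Ventures.YMGap.SlabAreaLawDimensions (su2_oneLinkKRModulus_one_one)
open Summit.Ventures.YMGap.StateLipschitz
open Summit.Ventures.YMGap.RobustBall.StateStability

namespace Summit.Ventures.YMGap.RobustBall.StateStabilityRows

variable {d N : ℕ}

/-! ## §1 Hypothesis-free rows at the Wilson centre -/

/-- **`SU(2)`, `d = 4`, Wilson units, HYPOTHESIS-FREE** (quarter modulus of the tree, `K = 1` on `‖B‖_op ≤ 1`): for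
`0 ≤ β_W < 2/9`, every member `(W, supp)` of the tier-1 `ℤ⁴` ball `MemBallZd ε₀ ε₁ R'` (any `ε₀`), every DLR state
`ν` of the member at bare coupling `β_W/2` and the Wilson DLR state `μ` there:
`|∫ f dμ − ∫ f dν| ≤ (√2 ε₀ / (2 − 9β_W)) · Σ δ(f)`. [cite: Follmer1988, Ch. I Comparison Theorem (2.8)] -/
theorem su2_abs_integral_sub_integral_le_of_memBallZd {βW ε₀ ε₁ R' : ℝ} (h0 : 0 ≤ βW) (h29 : βW < 2 / 9)
    {W : Potential (ZdEdge 4) (Matrix.specialUnitaryGroup (Fin 2) ℂ)}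
    {supp : Finset (ZdEdge 4) → Finset (Finset (ZdEdge 4))} (hmem : MemBallZd ε₀ ε₁ R' W supp)
    {μ ν : Measure (LGConfig 4 (Matrix.specialUnitaryGroup (Fin 2) ℂ))}
    (hμ : μ ∈ ymGibbsMeasures (d := 4) (fundamentalRep (Fin 2)) (2 * (βW / 4)))
    (hν : ν ∈ perturbedGibbsMeasures (d := 4) (fundamentalRep (Fin 2)) (2 * (βW / 4)) W supp)
    {f : LGConfig 4 (Matrix.specialUnitaryGroup (Fin 2) ℂ) → ℝ} (hfm : Measurable f)
    {Δ : Finset (ZdEdge 4)} (hfdep : DependsOn f (↑Δ : Set (ZdEdge 4))) {M : ℝ} (hM : ∀ σ, |f σ| ≤ M)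
    {δ : ZdEdge 4 → ℝ} (hδ : IsLipBound suFrobDist f δ) :
    |(∫ σ, f σ ∂μ) - ∫ σ, f σ ∂ν| ≤ Real.sqrt 2 * ε₀ / (2 - 9 * βW) * ∑ y ∈ Δ, δ y := by
  have hR : |βW / 4| * (2 * (((4 : ℕ) : ℝ) - 1)) ≤ 1 := by
    rw [abs_of_nonneg (by positivity)]; push_cast; linarith
  have hs : 6 * (((4 : ℕ) : ℝ) - 1) * |βW / 4| * 1 < 1 := by
    rw [abs_of_nonneg (by positivity)]; push_cast; linarith
  have key := abs_integral_sub_integral_le_of_memBallZd (d := 4) (N := 2) (by norm_num) le_rfl zero_le_one hR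
    su2_oneLinkKRModulus_one_one hs hmem hμ hν hfm hfdep hM hδ
  have he : Real.sqrt ((2 : ℕ) : ℝ) * ε₀ / 2 / (1 - 6 * (((4 : ℕ) : ℝ) - 1) * |βW / 4| * 1) =
      Real.sqrt 2 * ε₀ / (2 - 9 * βW) := by
    have h9 : (2 : ℝ) - 9 * βW ≠ 0 := by linarith
    rw [abs_of_nonneg (by positivity : (0 : ℝ) ≤ βW / 4)]
    push_cast
    rw [div_div, div_eq_div_iff (by linarith) h9]
    ring
  rw [he] at key
  exact key

/-- **Every `SU(N)`, every `d ≥ 2`, HYPOTHESIS-FREE** (Bakry–Émery modulus `oneLinkKRModulus_SU`): for 't Hooft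
`|β| ≤ b₀ < 1/(16(d−1))`, every member of `MemBallZd ε₀ ε₁ R'`, every DLR state `ν` of the member and the Wilson DLR
state `μ` at `β`: `|∫ f dμ − ∫ f dν| ≤ (√N ε₀ / (2 (1 − 16(d−1) b₀))) · Σ δ(f)`.
[cite: arXiv220412737, Lemma 4.1 with (4.7)-(4.8), Cor. 4.4 (4.11) and Rem. 1.3] -/
theorem abs_integral_sub_integral_le_of_memBallZd_SU (hd : 2 ≤ d) (hN : 2 ≤ N) {b₀ β ε₀ ε₁ R' : ℝ}
    (hb₀ : b₀ < 1 / (16 * ((d : ℝ) - 1))) (hβ : |β| ≤ b₀)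
    {W : Potential (ZdEdge d) (Matrix.specialUnitaryGroup (Fin N) ℂ)}
    {supp : Finset (ZdEdge d) → Finset (Finset (ZdEdge d))} (hmem : MemBallZd ε₀ ε₁ R' W supp)
    {μ ν : Measure (LGConfig d (Matrix.specialUnitaryGroup (Fin N) ℂ))}
    (hμ : μ ∈ ymGibbsMeasures (d := d) (fundamentalRep (Fin N)) (N * β))
    (hν : ν ∈ perturbedGibbsMeasures (d := d) (fundamentalRep (Fin N)) (N * β) W supp)
    {f : LGConfig d (Matrix.specialUnitaryGroup (Fin N) ℂ) → ℝ} (hfm : Measurable f)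
    {Δ : Finset (ZdEdge d)} (hfdep : DependsOn f (↑Δ : Set (ZdEdge d))) {M : ℝ} (hM : ∀ σ, |f σ| ≤ M)
    {δ : ZdEdge d → ℝ} (hδ : IsLipBound suFrobDist f δ) :
    |(∫ σ, f σ ∂μ) - ∫ σ, f σ ∂ν| ≤
      Real.sqrt N * ε₀ / (2 * (1 - 16 * ((d : ℝ) - 1) * b₀)) * ∑ y ∈ Δ, δ y := by
  have hd2 : (2 : ℝ) ≤ d := by exact_mod_cast hd
  have hd0 : (0 : ℝ) < (d : ℝ) - 1 := by linarith
  have hb₀0 : 0 ≤ b₀ := (abs_nonneg β).trans hβ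
  have h16 : 16 * ((d : ℝ) - 1) * b₀ < 1 := by
    have h := (lt_div_iff₀ (by positivity : (0 : ℝ) < 16 * ((d : ℝ) - 1))).1 hb₀
    linarith [mul_comm b₀ (16 * ((d : ℝ) - 1))]
  set R : ℝ := 2 * ((d : ℝ) - 1) * b₀ with hRdef
  have hRhalf : R < 1 / 2 := by rw [hRdef]; nlinarith
  have hA : 0 < 1 / 2 - R := sub_pos.2 hRhalf
  set K : ℝ := 1 / (1 / 2 - R) with hKdef
  have hK : 0 ≤ K := by rw [hKdef]; positivity
  have hmod : OneLinkKRModulus N R K := oneLinkKRModulus_SU hN hRhalf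
  have hRβ : |β| * (2 * ((d : ℝ) - 1)) ≤ R := by rw [hRdef]; nlinarith
  have hden : 0 < 1 - 16 * ((d : ℝ) - 1) * b₀ := by linarith
  have hK' : K = (1 / 2 - R)⁻¹ := by rw [hKdef, one_div]
  have h1 : 1 - 6 * ((d : ℝ) - 1) * |β| * K = (1 / 2 - R - 6 * ((d : ℝ) - 1) * |β|) / (1 / 2 - R) := by
    rw [hK', eq_div_iff hA.ne', sub_mul, one_mul, mul_assoc (6 * ((d : ℝ) - 1) * |β|),
      inv_mul_cancel₀ hA.ne', mul_one]
  have hgap : 0 < 1 / 2 - R - 6 * ((d : ℝ) - 1) * |β| := by rw [hRdef]; nlinarith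
  have hsmall : 6 * ((d : ℝ) - 1) * |β| * K < 1 := by
    have : 0 < 1 - 6 * ((d : ℝ) - 1) * |β| * K := by rw [h1]; positivity
    linarith
  -- the oscillation load is nonnegative
  obtain ⟨osc, lip, hosc, -, hosca, -⟩ := hmem.loads
  have hε₀ : 0 ≤ ε₀ := by
    have e₀ : ZdEdge d := (0, ⟨0, by omega⟩)
    exact (Finset.sum_nonneg fun X _ => (hosc X).nonneg e₀).trans (hosca e₀)
  have key := abs_integral_sub_integral_le_of_memBallZd hd hN hK hRβ hmod hsmall hmem hμ hν hfm hfdep hM hδ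
  refine key.trans ?_
  have hS : 0 ≤ ∑ y ∈ Δ, δ y := Finset.sum_nonneg fun y _ => hδ.nonneg y
  -- `1/(1 − c) = (1/2 − R)/(1/2 − R − 6(d−1)|β|) ≤ (1/2)/(1/2 − 8(d−1)b₀) = 1/(1 − 16(d−1)b₀)`
  have hinv : 1 / (1 - 6 * ((d : ℝ) - 1) * |β| * K) ≤ 1 / (1 - 16 * ((d : ℝ) - 1) * b₀) := by
    rw [h1, one_div_div, div_le_div_iff₀ hgap hden]
    have hR0 : 0 ≤ R := by rw [hRdef]; positivity
    have hx : 6 * ((d : ℝ) - 1) * |β| ≤ 3 * R := by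
      rw [hRdef]; nlinarith [mul_le_mul_of_nonneg_left hβ hd0.le]
    have h8R : 8 * R ≤ 1 := by rw [hRdef]; linarith
    have hRR : 8 * R ^ 2 ≤ R := by nlinarith
    have h16R : 16 * ((d : ℝ) - 1) * b₀ = 8 * R := by rw [hRdef]; ring
    rw [h16R]
    nlinarith
  calc Real.sqrt N * ε₀ / 2 / (1 - 6 * ((d : ℝ) - 1) * |β| * K) * ∑ y ∈ Δ, δ y
      = 1 / (1 - 6 * ((d : ℝ) - 1) * |β| * K) * (Real.sqrt N * ε₀ / 2 * ∑ y ∈ Δ, δ y) := by ring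
    _ ≤ 1 / (1 - 16 * ((d : ℝ) - 1) * b₀) * (Real.sqrt N * ε₀ / 2 * ∑ y ∈ Δ, δ y) :=
        mul_le_mul_of_nonneg_right hinv (by positivity)
    _ = Real.sqrt N * ε₀ / (2 * (1 - 16 * ((d : ℝ) - 1) * b₀)) * ∑ y ∈ Δ, δ y := by
        field_simp

/-! ## §2 Two members: the state is Lipschitz across the `SU(2)` ball -/

/-- **`SU(2)`, `d = 4`: the DLR state is Lipschitz ACROSS THE BALL in the oscillation-load seminorm** (rb-p1's
lineage-(B) door).  For `0 ≤ β_W ≤ 1/6`, two members `(W₁, supp)`, `(W₂, supp)` of `MemBallZd (2ε) ε R'` (common support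
family), the door constant `ρ = 3√3 β_W e^{2ε} + e^{ε} √(2/3) ε < 1`, and per-link oscillation witnesses of `W₁ − W₂` of load
`≤ η`: every DLR state `ν₁` of member 1 and `ν₂` of member 2 satisfy
`|∫ f dν₁ − ∫ f dν₂| ≤ (√2 η / 2) / (1 − ρ) · Σ δ(f)`. [cite: Follmer1988, Ch. I Comparison Theorem (2.8)] -/
theorem su2_abs_integral_sub_integral_le_of_members {βW ε R' η : ℝ} (h0 : 0 ≤ βW) (h6 : βW ≤ 1 / 6)
    {W₁ W₂ : Potential (ZdEdge 4) (Matrix.specialUnitaryGroup (Fin 2) ℂ)}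
    {supp : Finset (ZdEdge 4) → Finset (Finset (ZdEdge 4))} (hmem₁ : MemBallZd (2 * ε) ε R' W₁ supp)
    (hmem₂ : MemBallZd (2 * ε) ε R' W₂ supp)
    (hρ : 3 * Real.sqrt 3 * βW * exp (2 * ε) + exp ε * Real.sqrt (2 / 3) * ε < 1)
    {osc : Finset (ZdEdge 4) → ZdEdge 4 → ℝ} (hosc : ∀ X, Dobrushin.IsOscBound ((W₁ - W₂) X) (osc X))
    (hη : ∀ e, ∑ X ∈ (supp {e}).filter (fun X => e ∈ X), osc X e ≤ η)
    {ν₁ ν₂ : Measure (LGConfig 4 (Matrix.specialUnitaryGroup (Fin 2) ℂ))}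
    (hν₁ : ν₁ ∈ perturbedGibbsMeasures (d := 4) (fundamentalRep (Fin 2)) (2 * (βW / 4)) W₁ supp)
    (hν₂ : ν₂ ∈ perturbedGibbsMeasures (d := 4) (fundamentalRep (Fin 2)) (2 * (βW / 4)) W₂ supp)
    {f : LGConfig 4 (Matrix.specialUnitaryGroup (Fin 2) ℂ) → ℝ} (hfm : Measurable f)
    {Δ : Finset (ZdEdge 4)} (hfdep : DependsOn f (↑Δ : Set (ZdEdge 4))) {M : ℝ} (hM : ∀ σ, |f σ| ≤ M)
    {δ : ZdEdge 4 → ℝ} (hδ : IsLipBound suFrobDist f δ) :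
    |(∫ σ, f σ ∂ν₁) - ∫ σ, f σ ∂ν₂| ≤
      Real.sqrt 2 * η / 2 / (1 - (3 * Real.sqrt 3 * βW * exp (2 * ε) + exp ε * Real.sqrt (2 / 3) * ε)) *
        ∑ y ∈ Δ, δ y := by
  haveI : SecondCountableTopology (Matrix (Fin 2) (Fin 2) ℂ) :=
    inferInstanceAs (SecondCountableTopology (Fin 2 → Fin 2 → ℂ))
  haveI : SecondCountableTopology (Matrix.specialUnitaryGroup (Fin 2) ℂ) :=
    Topology.IsEmbedding.subtypeVal.secondCountableTopology
  obtain ⟨osc₁, lip₁, hosc₁, hlip₁, hosca₁, hΛ₁⟩ := hmem₁.loads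
  have hW₁ : W₁.IsAdapted := fun X => ⟨hmem₁.dependsOn X, (hmem₁.continuous X).measurable⟩
  have hW₁b : ∀ X, ∃ C, ∀ U, |W₁ X U| ≤ C := fun X => exists_bound_of_continuous (hmem₁.continuous X)
  have hW₂ : W₂.IsAdapted := fun X => ⟨hmem₂.dependsOn X, (hmem₂.continuous X).measurable⟩
  have hW₂b : ∀ X, ∃ C, ∀ U, |W₂ X U| ≤ C := fun X => exists_bound_of_continuous (hmem₂.continuous X)
  -- rb-p1's sharp one-link pair `(c, v) = (2/3, 2)` on `‖B‖_op ≤ 1/4`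
  have hc : (0 : ℝ) ≤ 2 / 3 := by norm_num
  have hb : |βW / 4| * (2 * (((4 : ℕ) : ℝ) - 1)) ≤ 1 / 4 := by
    rw [abs_of_nonneg (by positivity)]; push_cast; linarith
  have hP : ∀ B : Matrix (Fin 2) (Fin 2) ℂ, matrixOpNorm B ≤ 1 / 4 →
      ∀ (ψ : Matrix.specialUnitaryGroup (Fin 2) ℂ → ℝ) (M : ℝ), 0 ≤ M →
        (∀ x y, |ψ x - ψ y| ≤ M * suFrobDist x y) →
        Var[ψ; (haarProbability (Matrix.specialUnitaryGroup (Fin 2) ℂ)).tilted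
          fun g => ((2 : ℕ) : ℝ) * ((g : Matrix (Fin 2) (Fin 2) ℂ) * B).trace.re] ≤ 2 / 3 * M ^ 2 :=
    fun B hB ψ M hM hψ => oneLinkPoincareSUN_two_sharp _ B hB ψ M hM hψ
  have hKR := isKRContraction_perturbedYM_SU (d := 4) (N := 2) (by norm_num) (by norm_num) (a := 2 * ε) hc
    zero_le_two hb hP (su2_linVariance_sharp le_rfl) hW₁ hosc₁ hosca₁ hlip₁
  -- the row sums of the door coefficients are `≤ ρ`
  set ρ : ℝ := 3 * Real.sqrt 3 * βW * exp (2 * ε) + exp ε * Real.sqrt (2 / 3) * ε with hρdef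
  have hsq : Real.sqrt (2 / 3 * 2) = 2 * Real.sqrt 3 / 3 := by
    have h3 : (2 * Real.sqrt 3 / 3) ^ 2 = 2 / 3 * 2 := by
      rw [div_pow, mul_pow, Real.sq_sqrt (by norm_num)]; norm_num
    rw [← h3, Real.sqrt_sq (by positivity)]
  have hrow : ∀ e, ∑ y ∈ perturbedNbr supp e,
      (exp (2 * ε) * Real.sqrt (2 / 3 * 2) * |βW / 4| * linkInfluence e y +
        exp (2 * ε / 2) * Real.sqrt (2 / 3) * ∑ X ∈ (supp {e}).filter (fun X => e ∈ X), lip₁ X y) ≤ ρ := by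
    intro e
    refine (sum_perturbedNbr_coeff_le (d := 4) (by norm_num) hΛ₁ e).trans (le_of_eq ?_)
    rw [hsq, show 2 * ε / 2 = ε by ring, abs_of_nonneg (by positivity : (0 : ℝ) ≤ βW / 4), hρdef]
    push_cast
    ring
  have hρ0 : 0 ≤ ρ := by
    have hε : 0 ≤ ε := by
      have e₀ : ZdEdge 4 := (0, ⟨0, by norm_num⟩)
      have h := hΛ₁ e₀
      exact (Finset.sum_nonneg fun y _ => Finset.sum_nonneg fun X _ => (hlip₁ X).nonneg y).trans h
    positivity
  exact abs_integral_sub_integral_le_of_members (d := 4) (N := 2) (by norm_num) hW₁ hW₁b hW₂ hW₂b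
    hmem₁.supportedBy hmem₂.supportedBy hKR hρ0 hρ hrow hosc hη hν₁ hν₂ hfm hfdep hM hδ

end Summit.Ventures.YMGap.RobustBall.StateStabilityRows

end
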